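import Mathlib
import HarnessLib
import Literature.MathematicalPhysics.QuantumLattice.SectorisedKernelNorm
import Literature.MathematicalPhysics.QuantumLattice.HubbardFreeCovariance
import Literature.MathematicalPhysics.QuantumLattice.AngularSectors
import Summits.HubbardSuperconductivity.HubbardSuperconductivity.Theorems.KLProgrammeKLRegimeSplitConsts

/-!
# Route `KLProgramme` — crux K3 ENGINE (stmt-HubbardSuperconductivity-20437 `KLRegimeEngineV17F2`), stub (b) v2, THE LEVELS PACKAGE (ℓ), numerics side
# «(ℓ)-NUMERICS» part 1 (cell gate-hubbard-kl, seat p4 g21): THE LINK PINS IN CLOSED FORM, THE BLOCKING ROW, THE DEGREE CAPS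

The ∀j-assembly of the levels clause (`kernelNormsLevels_all_klEng[_sharp]`, k3c3-p2 g16, on this lineage's closer‴_klEng[♯]) carries, besides E1's data rows,
five NUMERICS binders: the blocking row `max 1 Z · C₂² · max 4 (2τψ) ≤ 2^(d−1)`, the row `B ≥ B₀`, the two coupling doors, the CE threshold(s), and two degree caps.
Under the KlEng link pins (`κb = √(2Cκe₀)`, `αb = Cb·(M/β)·4^d/e₀`, `crb = 81·CJ·M/β`, `ccb = 162·CJ·M/β`, `e₀ = klE0 = 1/32`, `imagTimeWeight β M = β/(2M)`) the law's
six names have CLOSED FORMS with every power of the time mesh `M/β` explicit — this file proves them and discharges the two M-free rows: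

* §1 pins: `W = 32·27⁴·e²`, `Z = e⁴·(81·CJ)²/8`, `τ·ψ = e⁶`, `max 4 (2τψ) = 2e⁶`, `σ = (2Cκe₀/(e⁴162²CJ²))·(β/M)²`, `τ = (e²·2Cκe₀/(162²CJ²))·(β/M)²`,
  `ψ = (e⁴162²CJ²/(2Cκe₀))·(M/β)²`, `Φ = (9·Cb·4^d/(27⁵·e·Cκ·e₀²))·(M/β)`;
* §2 blocking: `exists_blockLen_ge` (any real is below `2^(d−1)` from some `d₀ ≥ 2` on) and **`exists_blockLen_klEng`** — `∀ C₂ CJ, ∃ d₀ ≥ 2, ∀ d ≥ d₀`, under the pins,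
  `max 1 Z · C₂² · max 4 (2τψ) ≤ 2^(d−1)` (the assembly's `hblock` VERBATIM): the block length is a function of `(C₂, CJ)` alone;
* §3 caps: **`exists_degreeCap`** — for every `(L, M, d, n)` one `D ≥ 3` with `card(SpaceTimeIdx L M × SectorLeg (sectorCount (d·k−1)))/2 ≤ D` for every block
  `d·k ≤ n` and `card(HubbardFieldIdx L M) ≤ 2D+1` (the assembly's two cap rows VERBATIM): `D` is a bookkeeping choice, not a constraint.
The remaining numerics (doors, `B₀`, CE) are (M/β)-homogeneous of degree 0 after «(ℓ)-READOUT-CE-DIM» and are discharged in part 2 on reduced variables.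
Pure real arithmetic and finite cardinalities; nothing about the model is asserted; nothing asserts (ℓ), any stub, K3 or superconductivity.
References: BGM 2006 §2.8 (2.83)–(2.84), Lemma 2.5 (2.98) [cite: BenfattoGiulianiMastropietro2006].
-/

noncomputable section

namespace Summit.HubbardSuperconductivity.HubbardSuperconductivity.Theorems.EngineV8

set_option linter.dupNamespace false -- summit = problem name (single-conjunct summit), D-0017

open Real Finset Literature.MathematicalPhysics.QuantumLattice
open Summit.HubbardSuperconductivity.HubbardSuperconductivity.Theorems.KLRegimeSplit

/-! ## §1 The law's six names under the KlEng link pins, in closed form -/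

section Pins

variable {Cκ Cb CJ β : ℝ} {M d : ℕ} {κb αb crb ccb W Z σ Φ ψ τ : ℝ}

/-- `κb² = 2Cκe₀` and `κb ≠ 0` under the pin `κb = √(2Cκe₀)`, `Cκ > 0`. [folklore] -/
theorem levPin_κb_sq (hCκ : 0 < Cκ) (hκb : κb = Real.sqrt (2 * Cκ * klE0)) : κb ^ 2 = 2 * Cκ * klE0 ∧ κb ≠ 0 := by
  have he : (0 : ℝ) < klE0 := by norm_num [klE0]
  have h2 : 0 < 2 * Cκ * klE0 := by positivity
  refine ⟨by rw [hκb, Real.sq_sqrt h2.le], ?_⟩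
  rw [hκb]; exact (Real.sqrt_pos.2 h2).ne'

/-- **`W = 32·27⁴·e²`** under the pins `crb = 81·CJ·M/β`, `ccb = 162·CJ·M/β` (`CJ, β, M ≠ 0`). [folklore] -/
theorem levPin_W (hCJ : CJ ≠ 0) (hβ : β ≠ 0) (hM : (M : ℝ) ≠ 0) (hcrb : crb = 81 * CJ * M / β) (hccb : ccb = 162 * CJ * M / β)
    (hW : W = 64 * (27 : ℝ) ^ 4 * exp 2 * crb / ccb) : W = 32 * (27 : ℝ) ^ 4 * exp 2 := by
  rw [hW, hcrb, hccb]; field_simp; ring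

/-- **`Z = e⁴·(81·CJ)²/8`** under the pin `ccb = 162·CJ·M/β` and `imagTimeWeight β M = β/(2M)` (`β, M ≠ 0`). [folklore] -/
theorem levPin_Z (hβ : β ≠ 0) (hM : (M : ℝ) ≠ 0) (hccb : ccb = 162 * CJ * M / β) (hZ : Z = exp 4 * ccb ^ 2 * imagTimeWeight β M ^ 2 / 8) :
    Z = exp 4 * (81 * CJ) ^ 2 / 8 := by
  rw [hZ, hccb, imagTimeWeight]; field_simp; ring

/-- **`τ·ψ = e⁶`** under the pins (`Cκ > 0`, `CJ, β, M ≠ 0`). [folklore] -/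
theorem levPin_τψ (hCκ : 0 < Cκ) (hCJ : CJ ≠ 0) (hβ : β ≠ 0) (hM : (M : ℝ) ≠ 0) (hκb : κb = Real.sqrt (2 * Cκ * klE0)) (hccb : ccb = 162 * CJ * M / β)
    (hψ : ψ = exp 4 * ccb ^ 2 / κb ^ 2) (hτ : τ = exp 2 * κb ^ 2 / ccb ^ 2) : τ * ψ = exp 6 := by
  obtain ⟨hκ2, hκ0⟩ := levPin_κb_sq hCκ hκb
  have hccb0 : ccb ≠ 0 := by rw [hccb]; exact div_ne_zero (mul_ne_zero (mul_ne_zero (by norm_num) hCJ) hM) hβ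
  rw [hτ, hψ, show (6 : ℝ) = 2 + 4 by norm_num, Real.exp_add]; field_simp

/-- **`max 4 (2τψ) = 2e⁶`** under the pins. [folklore] -/
theorem levPin_ρk (hCκ : 0 < Cκ) (hCJ : CJ ≠ 0) (hβ : β ≠ 0) (hM : (M : ℝ) ≠ 0) (hκb : κb = Real.sqrt (2 * Cκ * klE0)) (hccb : ccb = 162 * CJ * M / β)
    (hψ : ψ = exp 4 * ccb ^ 2 / κb ^ 2) (hτ : τ = exp 2 * κb ^ 2 / ccb ^ 2) : max 4 (2 * τ * ψ) = 2 * exp 6 := by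
  rw [mul_assoc, levPin_τψ hCκ hCJ hβ hM hκb hccb hψ hτ]
  refine max_eq_right ?_
  have h6 : (7 : ℝ) ≤ exp 6 := by have := Real.add_one_le_exp (6 : ℝ); linarith
  linarith

/-- **`σ = (2Cκe₀/(e⁴·162²·CJ²))·(β/M)²`** under the pins. [folklore] -/
theorem levPin_σ (hCκ : 0 < Cκ) (hCJ : CJ ≠ 0) (hβ : β ≠ 0) (hM : (M : ℝ) ≠ 0) (hκb : κb = Real.sqrt (2 * Cκ * klE0)) (hccb : ccb = 162 * CJ * M / β)
    (hσ : σ = κb ^ 2 / (exp 4 * ccb ^ 2)) : σ = 2 * Cκ * klE0 / (exp 4 * 162 ^ 2 * CJ ^ 2) * (β / M) ^ 2 := by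
  obtain ⟨hκ2, _⟩ := levPin_κb_sq hCκ hκb
  rw [hσ, hκ2, hccb]; field_simp

/-- **`τ = (e²·2Cκe₀/(162²·CJ²))·(β/M)²`** under the pins. [folklore] -/
theorem levPin_τ (hCκ : 0 < Cκ) (hCJ : CJ ≠ 0) (hβ : β ≠ 0) (hM : (M : ℝ) ≠ 0) (hκb : κb = Real.sqrt (2 * Cκ * klE0)) (hccb : ccb = 162 * CJ * M / β)
    (hτ : τ = exp 2 * κb ^ 2 / ccb ^ 2) : τ = exp 2 * (2 * Cκ * klE0) / (162 ^ 2 * CJ ^ 2) * (β / M) ^ 2 := by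
  obtain ⟨hκ2, _⟩ := levPin_κb_sq hCκ hκb
  rw [hτ, hκ2, hccb]; field_simp

/-- **`ψ = (e⁴·162²·CJ²/(2Cκe₀))·(M/β)²`** under the pins. [folklore] -/
theorem levPin_ψ (hCκ : 0 < Cκ) (hCJ : CJ ≠ 0) (hβ : β ≠ 0) (hM : (M : ℝ) ≠ 0) (hκb : κb = Real.sqrt (2 * Cκ * klE0)) (hccb : ccb = 162 * CJ * M / β)
    (hψ : ψ = exp 4 * ccb ^ 2 / κb ^ 2) : ψ = exp 4 * 162 ^ 2 * CJ ^ 2 / (2 * Cκ * klE0) * ((M : ℝ) / β) ^ 2 := by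
  obtain ⟨hκ2, hκ0⟩ := levPin_κb_sq hCκ hκb
  have he : (0 : ℝ) < klE0 := by norm_num [klE0]
  rw [hψ, hκ2, hccb]; field_simp

/-- **`Φ = (9·Cb·4^d/(27⁵·e·Cκ·e₀²))·(M/β)`** under the pins. [folklore] -/
theorem levPin_Φ (hCκ : 0 < Cκ) (hCJ : CJ ≠ 0) (hβ : β ≠ 0) (hM : (M : ℝ) ≠ 0) (hκb : κb = Real.sqrt (2 * Cκ * klE0))
    (hαb : αb = Cb * ((M : ℝ) / β) * (4 : ℝ) ^ d / klE0) (hcrb : crb = 81 * CJ * M / β) (hccb : ccb = 162 * CJ * M / β)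
    (hΦ : Φ = 9 * αb * ccb / ((27 : ℝ) ^ 5 * exp 1 * κb ^ 2 * crb)) : Φ = 9 * Cb * (4 : ℝ) ^ d / ((27 : ℝ) ^ 5 * exp 1 * Cκ * klE0 ^ 2) * ((M : ℝ) / β) := by
  obtain ⟨hκ2, hκ0⟩ := levPin_κb_sq hCκ hκb
  have he : (klE0 : ℝ) ≠ 0 := by norm_num [klE0]
  rw [hΦ, hκ2, hαb, hcrb, hccb]; field_simp; ring

end Pins

/-! ## §2 The blocking row -/

/-- Any real number is below `2^(d−1)` for every block length `d` beyond some `d₀ ≥ 2`. [folklore] -/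
theorem exists_blockLen_ge (X : ℝ) : ∃ d₀ : ℕ, 2 ≤ d₀ ∧ ∀ d : ℕ, d₀ ≤ d → X ≤ (2 : ℝ) ^ (d - 1) := by
  obtain ⟨k, hk⟩ := pow_unbounded_of_one_lt X (one_lt_two : (1 : ℝ) < 2)
  refine ⟨max 2 (k + 1), le_max_left _ _, fun d hd => hk.le.trans ?_⟩
  exact pow_le_pow_right₀ (by norm_num) (by omega)

/-- **THE BLOCKING ROW IS A CHOICE OF THE BLOCK LENGTH**: for every `C₂, CJ` there is `d₀ ≥ 2` such that for every `d ≥ d₀`, under the KlEng pins (any `Cκ > 0`,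
`β, M ≠ 0`), the assembly's blocking row `max 1 Z · C₂² · max 4 (2τψ) ≤ 2^(d−1)` holds. [cite: BenfattoGiulianiMastropietro2006, §2.8 (2.83)-(2.84)] -/
theorem exists_blockLen_klEng (C₂ CJ : ℝ) : ∃ d₀ : ℕ, 2 ≤ d₀ ∧ ∀ d : ℕ, d₀ ≤ d →
    ∀ (Cκ β : ℝ) (M : ℕ), 0 < Cκ → CJ ≠ 0 → β ≠ 0 → (M : ℝ) ≠ 0 →
    ∀ (κb ccb Z ψ τ : ℝ), κb = Real.sqrt (2 * Cκ * klE0) → ccb = 162 * CJ * M / β → Z = exp 4 * ccb ^ 2 * imagTimeWeight β M ^ 2 / 8 →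
      ψ = exp 4 * ccb ^ 2 / κb ^ 2 → τ = exp 2 * κb ^ 2 / ccb ^ 2 →
      max 1 Z * C₂ ^ 2 * max 4 (2 * τ * ψ) ≤ (2 : ℝ) ^ (d - 1) := by
  obtain ⟨d₀, hd₀, h⟩ := exists_blockLen_ge (max 1 (exp 4 * (81 * CJ) ^ 2 / 8) * C₂ ^ 2 * (2 * exp 6))
  refine ⟨d₀, hd₀, fun d hd Cκ β M hCκ hCJ hβ hM κb ccb Z ψ τ hκb hccb hZ hψ hτ => ?_⟩
  rw [levPin_Z hβ hM hccb hZ, levPin_ρk hCκ hCJ hβ hM hκb hccb hψ hτ]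
  exact h d hd

/-! ## §3 The degree caps -/

/-- **THE DEGREE CAPS ARE A BOOKKEEPING CHOICE**: for every `(L, M, d, n)` there is `D ≥ 3` capping half the cardinality of every block's index type
`SpaceTimeIdx L M × SectorLeg (sectorCount (d·k−1))`, `d·k ≤ n`, and with `card (HubbardFieldIdx L M) ≤ 2D + 1`. [folklore] -/
theorem exists_degreeCap (L M d n : ℕ) [NeZero L] [NeZero M] : ∃ D : ℕ, 3 ≤ D ∧
    (∀ k, 1 ≤ k → d * k ≤ n → Fintype.card (SpaceTimeIdx L M × SectorLeg (sectorCount (d * k - 1))) / 2 ≤ D) ∧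
    Fintype.card (HubbardFieldIdx L M) ≤ 2 * D + 1 := by
  refine ⟨3 + Fintype.card (HubbardFieldIdx L M) + ∑ i ∈ range (n + 1), Fintype.card (SpaceTimeIdx L M × SectorLeg (sectorCount i)),
    by omega, fun k _ hk => ?_, by omega⟩
  have hi : d * k - 1 ∈ range (n + 1) := by rw [mem_range]; omega
  have hle : Fintype.card (SpaceTimeIdx L M × SectorLeg (sectorCount (d * k - 1))) ≤
      ∑ i ∈ range (n + 1), Fintype.card (SpaceTimeIdx L M × SectorLeg (sectorCount i)) :=
    single_le_sum (f := fun i => Fintype.card (SpaceTimeIdx L M × SectorLeg (sectorCount i))) (fun _ _ => Nat.zero_le _) hi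
  omega

end Summit.HubbardSuperconductivity.HubbardSuperconductivity.Theorems.EngineV8

end
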